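import Literature.Computability.Complexity.BoolEncodings
import HarnessLib

/-!
# Preliminaries for the diagonalizing machine: enumerating binary words, un-pairing

Literature / complexity toolkit (pure combinatorics used by the exhaustive search of the
diagonalizer of the nondeterministic time hierarchy theorem, `NTIMEHierarchyDiagonal.lean`).

* `bsucc` — the successor of a binary word in the enumeration by (length, value): little-endian
  increment, an all-ones word being followed by the all-zeros word one longer; `brank` — the
  position of a word in this enumeration (`2^{|v|} - 1 + bitsToNat v`); `brank_bsucc`,
  `brank_injective`, `iterate_bsucc_brank` (`bsucc^[brank v] [] = v`): iterating `bsucc` from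
  the empty word visits every word, those of length `≤ N` first (`brank_lt_iff`).
* `unpair` — the inverse of the pair code `boolPair y t = double(y) ++ [0,1] ++ t`
  (`BoolEncodings.lean`) as a PARTIAL function on words (`none` on malformed words, which the
  total `boolUnpair` of `BoolEncodings.lean` maps to junk), with `unpair_boolPair`,
  `eq_boolPair_of_unpair` and the bridge `boolUnpair_eq_of_unpair` to `boolUnpair`.
Values of words are the tree's `bitsToNat` (`BoolEncodings.lean`, little-endian).

## References

* S. Arora, B. Barak, *Computational Complexity: A Modern Approach*, CUP 2009, §1.2
  (representing pairs and enumerating strings). [folklore]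
-/

namespace Literature.Computability.Complexity

namespace DiagPrelims

/-! ### The enumeration of binary words -/

/-- Whether a word is all ones. [folklore] -/
def allOnes (v : List Bool) : Prop := ∀ b ∈ v, b = true

/-- `allOnes` is decidable. [folklore] -/
instance (v : List Bool) : Decidable (allOnes v) := by unfold allOnes; infer_instance

/-- The value of an all-ones word. [folklore] -/
theorem bitsToNat_of_allOnes {v : List Bool} (h : allOnes v) : bitsToNat v + 1 = 2 ^ v.length := by
  induction v with
  | nil => simp
  | cons b v ih =>
    have hb : b = true := h b (by simp)
    have ih' := ih (fun b' hb' => h b' (by simp [hb']))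
    subst hb
    simp [pow_succ]; omega

/-- Little-endian increment of a word that is not all ones (length preserved). [folklore] -/
def binc : List Bool → List Bool
  | [] => []
  | true :: v => false :: binc v
  | false :: v => true :: v

/-- `binc` preserves the length. [folklore] -/
@[simp] theorem length_binc (v : List Bool) : (binc v).length = v.length := by
  induction v with
  | nil => rfl
  | cons b v ih => cases b <;> simp [binc, ih]

/-- `binc` increments the value of a word that is not all ones. [folklore] -/
theorem bitsToNat_binc {v : List Bool} (h : ¬ allOnes v) : bitsToNat (binc v) = bitsToNat v + 1 := by
  induction v with
  | nil => exact absurd (fun b hb => by simp at hb) h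
  | cons b v ih =>
    cases b with
    | false => simp [binc]; omega
    | true =>
      have h' : ¬ allOnes v := fun hv => h (fun b hb => by
        rcases List.mem_cons.1 hb with rfl | hb
        · rfl
        · exact hv b hb)
      simp [binc, ih h']; omega

/-- **The successor** in the enumeration of words by length then value. [folklore] -/
def bsucc (v : List Bool) : List Bool :=
  if allOnes v then List.replicate (v.length + 1) false else binc v

/-- **The rank** of a word in the enumeration. [folklore] -/
def brank (v : List Bool) : ℕ := 2 ^ v.length - 1 + bitsToNat v

/-- The rank of the empty word. [folklore] -/
@[simp] theorem brank_nil : brank [] = 0 := by simp [brank]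

/-- The rank determines the length: `2^{|v|} - 1 ≤ brank v < 2^{|v|+1} - 1`. [folklore] -/
theorem brank_bounds (v : List Bool) : 2 ^ v.length - 1 ≤ brank v ∧ brank v < 2 ^ (v.length + 1) - 1 := by
  have h := bitsToNat_lt v
  have hp : 1 ≤ 2 ^ v.length := Nat.one_le_two_pow
  simp only [brank, pow_succ]; omega

/-- Words of length `≤ N` are exactly those of rank `< 2^{N+1} - 1`. [folklore] -/
theorem brank_lt_iff (v : List Bool) (N : ℕ) : brank v < 2 ^ (N + 1) - 1 ↔ v.length ≤ N := by
  obtain ⟨h1, h2⟩ := brank_bounds v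
  constructor
  · intro h
    by_contra hN
    have : 2 ^ (N + 1) ≤ 2 ^ v.length := Nat.pow_le_pow_right (by norm_num) (by omega)
    omega
  · intro h
    have : 2 ^ (v.length + 1) ≤ 2 ^ (N + 1) := Nat.pow_le_pow_right (by norm_num) (by omega)
    omega

/-- **The successor raises the rank by one.** [folklore] -/
theorem brank_bsucc (v : List Bool) : brank (bsucc v) = brank v + 1 := by
  unfold bsucc
  by_cases h : allOnes v
  · rw [if_pos h]
    have hv := bitsToNat_of_allOnes h
    simp only [brank, List.length_replicate, bitsToNat_replicate_false, pow_succ]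
    have hp : 1 ≤ 2 ^ v.length := Nat.one_le_two_pow
    omega
  · rw [if_neg h]
    simp only [brank, length_binc, bitsToNat_binc h]
    omega

/-- The rank of the iterated successor of the empty word. [folklore] -/
theorem brank_iterate_bsucc (i : ℕ) : brank (bsucc^[i] []) = i := by
  induction i with
  | zero => simp
  | succ i ih => rw [Function.iterate_succ_apply', brank_bsucc, ih]

/-- Equal lengths and equal values force equal words. [folklore] -/
theorem eq_of_bitsToNat_eq : ∀ {v w : List Bool}, v.length = w.length → bitsToNat v = bitsToNat w → v = w
  | [], [], _, _ => rfl
  | [], _ :: _, h, _ => by simp at h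
  | _ :: _, [], h, _ => by simp at h
  | b :: v, b' :: w, hl, hv => by
    simp only [bitsToNat_cons] at hv
    simp only [List.length_cons, Nat.add_right_cancel_iff] at hl
    have hb : b = b' := by
      cases b <;> cases b' <;> simp at hv ⊢ <;> omega
    subst hb
    have : bitsToNat v = bitsToNat w := by omega
    rw [eq_of_bitsToNat_eq hl this]

/-- **The rank is injective.** [folklore] -/
theorem brank_injective : Function.Injective brank := by
  intro v w h
  obtain ⟨hv1, hv2⟩ := brank_bounds v
  obtain ⟨hw1, hw2⟩ := brank_bounds w
  have hl : v.length = w.length := by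
    by_contra hne
    rcases Nat.lt_or_gt_of_ne hne with hlt | hlt
    · have : 2 ^ (v.length + 1) ≤ 2 ^ w.length := Nat.pow_le_pow_right (by norm_num) hlt
      omega
    · have : 2 ^ (w.length + 1) ≤ 2 ^ v.length := Nat.pow_le_pow_right (by norm_num) hlt
      omega
  refine eq_of_bitsToNat_eq hl ?_
  simp only [brank, hl] at h; omega

/-- **Iterating the successor from the empty word visits every word**, at step `brank v`.
[folklore] -/
theorem iterate_bsucc_brank (v : List Bool) : bsucc^[brank v] [] = v :=
  brank_injective (brank_iterate_bsucc _)

/-! ### Un-pairing -/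

/-- **The inverse of the pair code** `boolPair y t = (y.flatMap fun b => [b, b]) ++ false :: true :: t`
as a PARTIAL function: read pairs of equal symbols as the symbols of `y` until the separator `01`;
a word without separator (or with a `10` pair first) is `none`. The tree's `boolUnpair`
(`BoolEncodings.lean`) is the total version with junk values on malformed words; the two agree
wherever `unpair` is defined (`boolUnpair_eq_of_unpair`), and `unpair` moreover CERTIFIES
well-formedness (`eq_boolPair_of_unpair`), which the diagonalizer needs. [folklore] -/
def unpair : List Bool → Option (List Bool × List Bool)
  | b :: b' :: rest =>
    if b = b' then (unpair rest).map fun p => (b :: p.1, p.2)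
    else if b = false then some ([], rest) else none
  | _ => none

/-- Un-pairing a pair word. [folklore] -/
theorem unpair_boolPair (y t : List Bool) : unpair (boolPair y t) = some (y, t) := by
  induction y with
  | nil => simp [boolPair, unpair]
  | cons b y ih =>
    have : boolPair (b :: y) t = b :: b :: boolPair y t := by simp [boolPair]
    rw [this, unpair, if_pos rfl, ih]
    rfl

/-- A word that un-pairs is the pair word. [folklore] -/
theorem eq_boolPair_of_unpair : ∀ {v y t : List Bool}, unpair v = some (y, t) → v = boolPair y t
  | [], y, t, h => by simp [unpair] at h
  | [b], y, t, h => by simp [unpair] at h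
  | b :: b' :: rest, y, t, h => by
    rw [unpair] at h
    by_cases hb : b = b'
    · subst hb
      rw [if_pos rfl] at h
      cases hr : unpair rest with
      | none => rw [hr] at h; simp at h
      | some p =>
        rw [hr] at h
        simp only [Option.map_some, Option.some.injEq, Prod.mk.injEq] at h
        obtain ⟨rfl, rfl⟩ := h
        have := eq_boolPair_of_unpair (y := p.1) (t := p.2) (by rw [hr])
        rw [this]; simp [boolPair]
    · rw [if_neg hb] at h
      by_cases hf : b = false
      · subst hf
        rw [if_pos rfl] at h
        simp only [Option.some.injEq, Prod.mk.injEq] at h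
        obtain ⟨rfl, rfl⟩ := h
        have hb' : b' = true := by cases b' <;> simp_all
        subst hb'; simp [boolPair]
      · rw [if_neg hf] at h; simp at h

/-- Bridge to the total un-pairing of `BoolEncodings.lean`. [folklore] -/
theorem boolUnpair_eq_of_unpair {v y t : List Bool} (h : unpair v = some (y, t)) : boolUnpair v = (y, t) := by
  rw [eq_boolPair_of_unpair h, boolUnpair_boolPair]

/-- The components of an un-paired word are shorter. [folklore] -/
theorem length_of_unpair {v y t : List Bool} (h : unpair v = some (y, t)) : 2 * y.length + 2 + t.length = v.length := by
  rw [eq_boolPair_of_unpair h, length_boolPair]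

end DiagPrelims

end Literature.Computability.Complexity
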